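import Summits.CriticalPhenomena.Ising3DConformalLimit.Theorems.HyperoctahedralRPLimitRotationInvariantQuarterTurnDefs
import Literature.Probability.LatticeModels.IsingThermodynamics
import HarnessLib

/-!
# Vocabulary of the Markov/one-arm reshape of the open stub `stub_unitSigmaBound`
(line `quarter-turn-liouville`, crux `HyperoctahedralRP.LimitRotationInvariant`, item stmt-CriticalPhenomena-1980)

Route-posited vocabulary (D-0016) of the checked skeleton `Cruxes/LimitRotationInvariant/Lines/quarter_turn_liouville.lean`
from its v7 reshape (lead `prover-line-stmt-CriticalPhenomena-1980-c1-0`, 2026-08-16).  Everything here is definitional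
bookkeeping over tree declarations (`isingExpect`, `isingCorr`, `box`, `criticalBeta`, `criticalCorr`); the mathematics is in
the stub files `Theorems/HyperoctahedralRPLimitRotationInvariant{BoxSandwich,MidMagnetisation,SymBoxNorm,LatticeSandwich,
UnitSigmaOfLS}.lean` that import this module.

THE RESHAPE.  The line closes the crux modulo the unit sigma bound `‖e^{-H} σ̂(y) e^{-H}‖ ≤ C₁` on the OS space of the
lattice mirror `x₀ = 0` of the limit (`UnitSigmaBound`).  On the LATTICE the same quantity at mesh `δ = 1/n` is
`⟨F · σ_y · G⟩_{β_c}` with `F` supported in `{x₀ ≤ −n}`, `G` in `{x₀ ≥ n}`, `y` on the plane `x₀ = 0`; the spatial Markov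
property of the nearest-neighbour Gibbs weight across the plane sections `x₀ = ±n` writes it as `⟨φ · m · ψ⟩` with `φ, ψ` the
DLR conditional expectations of `F, G` and `m` the conditional magnetisation of `σ_y` in the slab given the two planes;
`|m| ≤ m⁺_{n−1}` (plus-box magnetisation) by FKG monotonicity in the boundary spins, Cauchy–Schwarz, and the reflection
positivity identity `⟨ψ²⟩ = ⟨G · θ_{P_n} G⟩` in a box symmetric about `P_n` give the LATTICE SANDWICH INEQUALITY
(`LatticeSandwich`) with constant `m⁺_{n−1}` and the exact (unpushed) OS norms; renormalising by `ρ(1/n)` and using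
`ρ(1/n)² ⟨σ₀σ_{2ne₀}⟩ → S₂(2e₀)` reduces `UnitSigmaBound` to the ONE-ARM HYPERSCALING BOUND `OneArmBound`:
`(m⁺_n)² ≤ C ⟨σ₀ σ_{2n e₀}⟩_{β_c}`, whose converse is a theorem (contract the plane: GKS + cut vertex) and which is the
line's open core after the reshape (true by scaling theory in `d = 3`, false for `d > 4`).  Credit for the Markov route:
`prover-pitem-stmt-CriticalPhenomena-5434-c2-0` (item evidence `SigmaBoundViaOneArm.md`, 2026-08-16).

Contents: `planeRefl`, `symBox`, `belowPlane`, `abovePlane`, `betweenPlanes`, `critPlusExpect`, `critFixedExpect`,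
`plusBoxMag`, and the statement `Prop`s `LatticeSandwich`, `OneArmBound`, `BoxSandwichStatement`, `MidMagnetisationStatement`,
`SymBoxNormStatement`, `UnitSigmaBound` — all PREDICATES (on the level `n`, the constant `C`, or the limit `S`); the registered stubs of
v7 are `stub_X : ∀ n, XStatement n`, `stub_oneArmBound : ∃ C, OneArmBound C` and two implications between them.

References: H.-O. Georgii, *Gibbs Measures and Phase Transitions* (2nd ed. 2011), §1.2–1.3 (specifications, DLR/Markov
property of nearest-neighbour potentials); S. Friedli, Y. Velenik, *Statistical Mechanics of Lattice Systems* (2017), §3.6–3.8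
(GKS, FKG, boundary monotonicity, thermodynamic limit of the plus state); J. Fröhlich, R. Israel, E. H. Lieb, B. Simon,
Comm. Math. Phys. 62 (1978) §3 (reflection positivity through site planes); M. Aizenman, H. Duminil-Copin, V. Sidoravicius,
Comm. Math. Phys. 334 (2015) (the critical plus state, `m*(β_c) = 0`).
-/

noncomputable section

open scoped BigOperators
open Literature.Probability.LatticeModels
open Literature.MathematicalPhysics.QuantumFieldTheory

namespace Summit.CriticalPhenomena.Ising3DConformalLimit.Cruxes.LimitRotationInvariant.QuarterTurnLiouville


/-! ### Geometry and finite-volume expectations -/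

/-- Reflection of `ℤ³` in the lattice plane `P_h = {x₀ = h}`: `x ↦ (2h − x₀, x₁, x₂)`. [folklore] -/
def planeRefl (h : ℤ) (x : Site 3) : Site 3 := Function.update x 0 (2 * h - x 0)

/-- The finite box `{x : |x₀ − h| ≤ R, |x₁| ≤ L, |x₂| ≤ L}`, symmetric under `planeRefl h`. [folklore] -/
def symBox (h : ℤ) (R L : ℕ) : Finset (Site 3) :=
  (box 3 (R + h.natAbs)).filter fun x => |x 0 - h| ≤ R ∧ |x 1| ≤ L ∧ |x 2| ≤ L

/-- The part of a finite region strictly below the plane `P_h`. [folklore] -/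
def belowPlane (h : ℤ) (Λ : Finset (Site 3)) : Finset (Site 3) := Λ.filter fun x => x 0 < h

/-- The part of a finite region strictly above the plane `P_h`. [folklore] -/
def abovePlane (h : ℤ) (Λ : Finset (Site 3)) : Finset (Site 3) := Λ.filter fun x => h < x 0

/-- The part of a finite region strictly between the planes `P_h` and `P_h'`. [folklore] -/
def betweenPlanes (h h' : ℤ) (Λ : Finset (Site 3)) : Finset (Site 3) := Λ.filter fun x => h < x 0 ∧ x 0 < h'

/-- Critical finite-volume Ising expectation on `Λ ⊂ ℤ³` with PLUS boundary condition, `⟨F⟩⁺_{Λ;β_c,0}`. [folklore] -/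
def critPlusExpect (Λ : Finset (Site 3)) (F : SpinConfig (Site 3) → ℝ) : ℝ :=
  isingExpect (zdGraph 3) Λ (criticalBeta 3) 0 .plus F

/-- Critical finite-volume Ising expectation on `Λ ⊂ ℤ³` with the boundary condition FIXED to the configuration `σ`
outside `Λ` (the DLR kernel of the critical specification): `⟨F⟩^σ_{Λ;β_c,0}`. [folklore] -/
def critFixedExpect (Λ : Finset (Site 3)) (σ : SpinConfig (Site 3)) (F : SpinConfig (Site 3) → ℝ) : ℝ :=
  isingExpect (zdGraph 3) Λ (criticalBeta 3) 0 (.fixed σ) F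

/-- The plus-boundary magnetisation at the centre of the cube `Λ_n = [−n,n]³` at `β_c`: `m⁺_n := ⟨σ_0⟩⁺_{Λ_n;β_c,0}`
(= the wired FK–Ising one-arm probability to `∂Λ_{n+1}`, `thetaWiredBox_succ_eq_isingCorr_plus`). [folklore] -/
def plusBoxMag (n : ℕ) : ℝ := isingCorr (zdGraph 3) (box 3 n) (criticalBeta 3) 0 .plus {0}

/-- **(LS) · the lattice sandwich inequality at level `n`** (a predicate on `n : ℕ`): in the critical state on `ℤ³`, a spin `σ_y` on the plane
`x₀ = 0` sandwiched between a signed combination of spin monomials supported in `{x₀ ≤ −n}` and one supported in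
`{x₀ ≥ n}` is bounded by `m⁺_{n−1}` times the two Osterwalder–Schrader norms taken with respect to the mirrors
`P_{−n}` and `P_n`. [folklore] -/
def LatticeSandwich (n : ℕ) : Prop :=
  1 ≤ n → ∀ (y : Site 3), y 0 = 0 →
    ∀ (m : ℕ) (k : Fin m → ℕ) (J : (a : Fin m) → Fin (k a) → Site 3) (c : Fin m → ℝ)
      (m' : ℕ) (k' : Fin m' → ℕ) (K : (b : Fin m') → Fin (k' b) → Site 3) (d : Fin m' → ℝ),
      (∀ a i, J a i 0 ≤ -(n : ℤ)) → (∀ b j, (n : ℤ) ≤ K b j 0) →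
      (∑ a, ∑ b, c a * d b *
          criticalCorr 3 (k a + 1 + k' b) (Fin.append (Fin.append (J a) ![y]) (K b))) ^ 2
        ≤ plusBoxMag (n - 1) ^ 2 *
          (∑ a, ∑ a', c a * c a' *
            criticalCorr 3 (k a + k a') (Fin.append (J a) (fun i => planeRefl (-(n : ℤ)) (J a' i)))) *
          (∑ b, ∑ b', d b * d b' *
            criticalCorr 3 (k' b + k' b') (Fin.append (K b) (fun j => planeRefl n (K b' j))))

/-- **(OA) · the one-arm hyperscaling bound with constant `C`** (a predicate on `C : ℝ`; the stub asserts `∃ C, OneArmBound C`): the plus-box magnetisation at the centre of `Λ_n` at `β_c`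
is at most a constant times the square root of the critical two-point function at distance `2n` along an axis.
TRUE by scaling theory in `d = 3` (both sides `≍ n^{-Δσ}` after the square root), its converse
`⟨σ₀σ_{2ne₀}⟩ ≤ m_wall(n)²` is a theorem (plane contraction, GKS), and it FAILS for `d > 4` (hyperscaling):
the open core of the line after the Markov reshape. [folklore] -/
def OneArmBound (C : ℝ) : Prop :=
  ∀ n : ℕ, 1 ≤ n → plusBoxMag n ^ 2 ≤ C * criticalCorr 3 2 ![0, Pi.single 0 (2 * (n : ℤ))]

/-- **Statement (c1) · finite-box Markov sandwich at level `n`.**  In the critical plus-boundary Ising measure on the slab box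
`B = symBox 0 M L`, for bounded measurable `F` depending only on `{x₀ ≤ −n}` and `G` depending only on `{x₀ ≥ n}` and a
site `y` on the plane `x₀ = 0`: `|⟨F σ_y G⟩_B| ≤ m · ⟨φ²⟩_B^{1/2} · ⟨ψ²⟩_B^{1/2}`, where `φ(σ) = ⟨F⟩^σ_{B ∩ {x₀ < −n}}`,
`ψ(σ) = ⟨G⟩^σ_{B ∩ {x₀ > n}}` are the DLR conditional expectations given the configuration off the two outer regions, and `m`
is any pointwise bound of the conditional magnetisation `σ ↦ ⟨σ_y⟩^σ_{B ∩ {|x₀| < n}}` (spatial Markov property of the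
nearest-neighbour Gibbs weight across the plane sections `x₀ = ±n`, then Cauchy–Schwarz). [folklore] -/
def BoxSandwichStatement (n : ℕ) : Prop :=
  ∀ (L M : ℕ), 1 ≤ n → n < M → ∀ (y : Site 3), y 0 = 0 → (∀ i, i ≠ 0 → |y i| ≤ L) →
    ∀ (F G : SpinConfig (Site 3) → ℝ), Measurable F → Measurable G →
      DependsOn F {x : Site 3 | x 0 ≤ -(n : ℤ)} → DependsOn G {x : Site 3 | (n : ℤ) ≤ x 0} →
      (∃ CF : ℝ, ∀ σ, |F σ| ≤ CF) → (∃ CG : ℝ, ∀ σ, |G σ| ≤ CG) →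
    ∀ (mb : ℝ), (∀ σ : SpinConfig (Site 3),
        |critFixedExpect (betweenPlanes (-(n : ℤ)) n (symBox 0 M L)) σ (spinAt y)| ≤ mb) →
      |critPlusExpect (symBox 0 M L) (fun σ => F σ * spinAt y σ * G σ)| ≤
        mb * Real.sqrt (critPlusExpect (symBox 0 M L)
                (fun σ => critFixedExpect (belowPlane (-(n : ℤ)) (symBox 0 M L)) σ F ^ 2)) *
             Real.sqrt (critPlusExpect (symBox 0 M L)
                (fun σ => critFixedExpect (abovePlane n (symBox 0 M L)) σ G ^ 2))

/-- **Statement (c2) · conditional magnetisation bound at level `n`.**  For every boundary configuration `σ`, the magnetisation of the plane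
spin `σ_y` in the slab piece `B ∩ {|x₀| < n}` is at most the plus-box magnetisation `m⁺_{n−1}` in absolute value (FKG
monotonicity in the boundary spins of either sign, spin flip, shrinking the domain under plus boundary condition,
translation). [folklore] -/
def MidMagnetisationStatement (n : ℕ) : Prop :=
  ∀ (L M : ℕ), 1 ≤ n → n < M → ∀ (y : Site 3), y 0 = 0 → (∀ i, i ≠ 0 → |y i| + n ≤ (L : ℤ)) →
    ∀ σ : SpinConfig (Site 3),
      |critFixedExpect (betweenPlanes (-(n : ℤ)) n (symBox 0 M L)) σ (spinAt y)| ≤ plusBoxMag (n - 1)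

/-- **Statement (c3a) · symmetric-box norm identity at level `n`.**  With `ψ(σ) = ⟨G⟩^σ_{B ∩ {x₀ > n}}` as in (c1) and the box
`B₊ = symBox n (M − n) L` (same upper part as `B`, symmetric under the reflection `planeRefl n`):
`⟨ψ²⟩_B = ⟨G · (G ∘ planeRefl n)⟩_{B₊} + (⟨G ψ⟩_B − ⟨G ψ⟩_{B₊})` (conditioning on the complement of the upper region in `B`
and in `B₊`, and the reflection symmetry of `B₊`). [folklore] -/
def SymBoxNormStatement (n : ℕ) : Prop :=
  ∀ (L M : ℕ), 1 ≤ n → 3 * n < M →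
    ∀ (G : SpinConfig (Site 3) → ℝ), Measurable G → DependsOn G {x : Site 3 | (n : ℤ) ≤ x 0} →
      DependsOn G (↑(abovePlane (n : ℤ) (symBox 0 M L) ∪ (symBox 0 M L).filter fun x => x 0 = n) : Set (Site 3)) →
      (∃ CG : ℝ, ∀ σ, |G σ| ≤ CG) →
      critPlusExpect (symBox 0 M L) (fun σ => critFixedExpect (abovePlane n (symBox 0 M L)) σ G ^ 2) =
        critPlusExpect (symBox n (M - n) L) (fun σ => G σ * G (σ ∘ planeRefl n)) +
        (critPlusExpect (symBox 0 M L) (fun σ => G σ * critFixedExpect (abovePlane n (symBox 0 M L)) σ G) -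
          critPlusExpect (symBox n (M - n) L) (fun σ => G σ * critFixedExpect (abovePlane n (symBox 0 M L)) σ G))

/-- **The unit sigma bound** (conclusion of the registered stub `stub_unitSigmaBound` of the line, as a `Prop` in `(ρ, Δ, S)`):
`‖e^{-H} σ̂(y) e^{-H}‖ ≤ C₁` on the Osterwalder–Schrader space of the mirror `x₀ = 0`, correlation-function form. [folklore] -/
def UnitSigmaBound (S : CorrFamily 3) : Prop :=
  ∃ C₁ : ℝ, ∀ y : EuclideanSpace ℝ (Fin 3), y 0 = 0 →
    ∀ (m : ℕ) (k : Fin m → ℕ) (A : (a : Fin m) → Fin (k a) → EuclideanSpace ℝ (Fin 3)) (c : Fin m → ℝ)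
      (m' : ℕ) (k' : Fin m' → ℕ) (B : (b : Fin m') → Fin (k' b) → EuclideanSpace ℝ (Fin 3))
      (d : Fin m' → ℝ),
      (∀ a i, 0 < A a i 0) → (∀ b j, 0 < B b j 0) →
      (∑ a, ∑ b, c a * d b * S (k a + 1 + k' b)
          (Fin.append (Fin.append (fun i => axisReflection 0 (A a i + EuclideanSpace.single 0 1)) ![y])
            (fun j => B b j + EuclideanSpace.single 0 1))) ^ 2
        ≤ C₁ ^ 2 *
          (∑ a, ∑ a', c a * c a' * S (k a + k a')
            (Fin.append (fun i => axisReflection 0 (A a i)) (A a'))) *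
          (∑ b, ∑ b', d b * d b' * S (k' b + k' b')
            (Fin.append (fun j => axisReflection 0 (B b j)) (B b')))

/-- `planeRefl h` is an involution. [folklore] -/
theorem planeRefl_planeRefl (h : ℤ) (x : Site 3) : planeRefl h (planeRefl h x) = x := by
  ext i
  by_cases hi : i = 0
  · subst hi; simp [planeRefl]
  · simp [planeRefl, hi]

/-- `planeRefl h` is an involution (the registered API sub-goal of skeleton v7, in its registered form). [folklore] -/
theorem stub_planeRefl_planeRefl : ∀ (h : ℤ) (x : Site 3), planeRefl h (planeRefl h x) = x :=
  planeRefl_planeRefl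

/-- `planeRefl h` fixes the plane `x₀ = h` pointwise. [folklore] -/
theorem planeRefl_of_eq {h : ℤ} {x : Site 3} (hx : x 0 = h) : planeRefl h x = x := by
  ext i
  by_cases hi : i = 0
  · subst hi; simp [planeRefl, hx]; ring
  · simp [planeRefl, hi]

/-- The zeroth coordinate of `planeRefl h x` is `2h − x₀`. [folklore] -/
@[simp] theorem planeRefl_apply_zero (h : ℤ) (x : Site 3) : planeRefl h x 0 = 2 * h - x 0 := by
  simp [planeRefl]

/-- The other coordinates are unchanged by `planeRefl h`. [folklore] -/
theorem planeRefl_apply_of_ne_zero (h : ℤ) (x : Site 3) {i : Fin 3} (hi : i ≠ 0) : planeRefl h x i = x i := by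
  simp [planeRefl, hi]

/-- Membership in `symBox h R L`. [folklore] -/
theorem mem_symBox {h : ℤ} {R L : ℕ} {x : Site 3} :
    x ∈ symBox h R L ↔ x ∈ box 3 (R + h.natAbs) ∧ |x 0 - h| ≤ R ∧ |x 1| ≤ L ∧ |x 2| ≤ L := by
  simp [symBox]

end Summit.CriticalPhenomena.Ising3DConformalLimit.Cruxes.LimitRotationInvariant.QuarterTurnLiouville

end
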